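/-
Copyright: cell pub-balaban-gaps (YM BLITZ Y1, track G1), seat g1-p2 GEN 7 (unit `pub-balaban-gaps-g1-p2`).  Row (D4) NODE O,
OBJECT level: [B9] (3.50)–(3.54) — the covariant Laplace operator in a background of TRANSPORT DEFECTS `W_b = R(U′_b) − 1` on the
fibred fine torus `Site P 0 × F`, its perturbation `V_W = Δ_1 ⊗ 1 − Δ_W` in the (3.52)-STRUCTURED form (site-local fibre coefficients
× the fibred differences `∂_μ ⊗ 1`, `S⁻_μ∂_μ ⊗ 1`), the (3.61)-shape DOMINATION LETTER from the two windows of (3.37) (bond window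
`‖W‖ ≤ ηα`, divergence window `‖Σ_{b∈st(x)}W_b‖ ≤ η²α′`), and — with 57∕58's hypothesis-free flat letters — [B9] Cor. 3.5's step for
`(G′ ⊗ 1)(1 − V_W(u)(G′ ⊗ 1))⁻¹`, constants uniform in `K`, the volume and the fibre.  HONEST FRAMING: the defects `W^±_μ(u, x)` are a
holomorphic hypothesis FAMILY with the two windows as named letters (for Bałaban's `U′ = e^{iηA}` they follow from (3.37) by the
expansion (3.51) — NOT typed here); the flat operator is the tree's scalar model ⊗ 1_F; the averaging corrections `F′₂` of (3.60)
are NOT included (this is the `V′₁` part); (D4) instance 0∕1; NOT BetaPertH, NOT continuum, NOT Clay.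
-/
import Summits.QuantumFields.BalabanUV.Gaps.D4WalkBlockCovariantGeometry
import Summits.QuantumFields.BalabanUV.Gaps.D4WalkBlockFlatFibre

/-!
# `Gaps.D4WalkBlockCovariantShift` — the covariant shift `V_W = Δ_1 ⊗ 1 − Δ_W` of (3.50)–(3.53) on the fibred fine torus: its
# (3.52)-structure, its (3.61) letter from the two windows, and Cor. 3.5's step on the genuine flat propagator
# (cell pub-balaban-gaps, seat g1-p2 gen 7)

HONEST DEPENDENCY (cell pub-balaban, verbatim): continuum YM on T⁴ ⇐ BetaPertH ∧ nine spine estimates (0/9 proved);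
BetaPertH ⇐ (D1) ∧ (D4) ∧ CAP+tail.

[B9] p. 400 (3.50): `(Δ_{U′U}λ)(x) = η⁻²(2dλ(x) − Σ_{b∈st(x)} exp(iη ad_{A′(b)})R(U_b)λ(b₊))`; (3.51)–(3.53): `Δ_{U′U} = Δ_U − V′₁(A)`;
(3.54) p. 401: `|(V′₁(A)λ)(x)| ≤ 4dα₁(Lʲη)⁻¹|∇_Uλ| + 2dα₁(Lʲη)⁻²|λ| + 8dα₁²(Lʲη)⁻²|λ|`.  At `U = 1` write `R(U′_b) = 1 + W_b` for the
`2d` bonds `b ∈ st(x)` — `W⁺_μ(x)` for `(x, x + e_μ)`, `W⁻_μ(x)` for `(x, x − e_μ)`.  Then `Δ_1 ⊗ 1 − Δ_W = η⁻²Σ_μ(W⁺_μS_μ + W⁻_μS⁻_μ)`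
and, since `S_μ = 1 + η∂_μ`, `S⁻_μ = 1 − ηS⁻_μ∂_μ`:  `V_W = [η⁻²Σ_μ(W⁺_μ + W⁻_μ)] + Σ_μ (η⁻¹W⁺_μ)·∂_μ − Σ_μ (η⁻¹W⁻_μ)·(S⁻_μ∂_μ)` — the
(3.52)-structure with SITE-LOCAL fibre coefficients.  THIS FILE takes that structured form as the DEFINITION of `V_W(u)` (§3) over a
holomorphic family of defects and proves:
* (part 1, `D4WalkBlockCovariantGeometry`: one fine step moves the unit cube by at most one; `fibDiag`, `SBf`, `blockNorm_SBf_mul_le`.)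
* §3 **`covShift`** `V_W(u)` and **`covShift_dominated`**: the (3.61)-shape domination letter `‖V_W(u)S‖ ≤ α′‖S‖ + Σ_μ α(‖(∂_μ⊗1)S‖ +
  ‖(S⁻_μ∂_μ⊗1)S‖)` from the BOND window `Σ_b‖W^±_μ(u,x)_{ab}‖ ≤ ηα` and the DIVERGENCE window `Σ_b‖(Σ_μ W⁺_μ + W⁻_μ)(u,x)_{ab}‖ ≤ η²α′`
  (print: first order `Σ_{b∈st(x)}W_b = iη²ad_{(∇*A)(x)}`, (3.37)'s `|∇A| ≤ α₁(Lʲη)⁻²` — the `2dα₁(Lʲη)⁻²|λ|` of (3.54)); `covShift_holo`.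
* §5 **`flatLap_sub_covLap`** — FAITHFULNESS: with `covLap` = (3.50)'s operator `η⁻²Σ_μ(2 − (1 + W⁺_μ)S_μ − (1 + W⁻_μ)S⁻_μ)` and
  `flatLap = η⁻²Σ_μ(2 − S_μ − S⁻_μ)`: `flatLap − covLap = covShift` (via `Sf_eq`: `S_μ = 1 + η∂_μ`, `SBf_mul_Sf`: `S⁻_μS_μ = 1`, `SBf_eq`).
* §4 **`blockWalkExpansion_covShift_oneScaleTorus`** — COR. 3.5's STEP FOR THE COVARIANT-LAPLACIAN PART ON THE GENUINE FLAT PROPAGATOR: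
  with 58's letters for `G′ ⊗ 1_F` (value, `∂_μ ⊗ 1`) and §2's relabelled letter for `S⁻_μ∂_μ ⊗ 1` (factor `e^{½δ₀}`), for every
  defect family with windows `(α, α′)` on the ball and the margin `c_μ(c_μ·1·(1·((α′ + Σ_μ(α + αe^{½δ₀}))C))c_μ)c_μ < 1` («α₁ sufficiently
  small» against `(C, δ₀, c_μ, d)` ONLY): `(Gc ⊗ 1)(1 − V_W(u)(Gc ⊗ 1))⁻¹` is a block walk expansion with derivative letters — uniform in
  `K`, the volume and the fibre.
WHAT IT IS NOT.  The defects of Bałaban's `U′ = e^{iηA}` with the windows DERIVED from (3.37) ((3.51)'s expansion of `exp(iη ad)`);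
the averaging part `F′₂*aQ′ + Q′*aF′₂ + F′₂*aF′₂` of (3.60); (D4) instance 0∕1; words of row (D4) UNCHANGED.

References: T. Bałaban, Comm. Math. Phys. **99** (1985) 389–434 [B9], (3.23) p. 394, (3.37) p. 396, (3.50)–(3.54) pp. 400–401,
(3.60)–(3.64) p. 402, Cor. 3.5 p. 407; Comm. Math. Phys. **96** (1984) 223–250 [4], Prop. 2.2 (2.67) p. 234.
-/

noncomputable section

namespace Summit.QuantumFields.BalabanUV.Gaps.D4WalkBlockCovariantShift

open Metric Set Finset
open scoped Matrix
open Literature.MathematicalPhysics.QuantumFieldTheory.Balaban1983to89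
open Literature.MathematicalPhysics.QuantumFieldTheory.Balaban1983to89.B9SectDWalk (DomBy)
open Literature.MathematicalPhysics.QuantumFieldTheory.Balaban1983to89.B9Thm34Ext (toB6)
open Literature.MathematicalPhysics.QuantumFieldTheory.Balaban1983to89.B9Thm37GlueTorus (torusGeom tdist1 tdist1_nonneg tdist1_comm)
open Literature.MathematicalPhysics.QuantumFieldTheory.Balaban1983to89.TreeLengthTorus (TPt)
open Literature.MathematicalPhysics.QuantumFieldTheory.Balaban1983to89.B5TorusCover (UT)
open Literature.MathematicalPhysics.QuantumFieldTheory.Balaban1983to89.B11SectG (RowSum)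
open Literature.MathematicalPhysics.QuantumFieldTheory.Balaban1983to89.B5Ineq137Torus (toT Nv blk blk_val)
open Literature.MathematicalPhysics.QuantumFieldTheory.Balaban1983to89.B4TorusKernel.MultiPeriod
  (circAbs circAbs_le_abs circAbs_add_mul circAbs_nonneg)
open Literature.MathematicalPhysics.QuantumFieldTheory.Balaban1983to89.B6Prop22OneScaleTorus (Index)
open Literature.MathematicalPhysics.QuantumFieldTheory.Balaban1983to89.B1RG242Torus (tower deriv)
open Summit.QuantumFields.BalabanUV.Gaps.D4WalkBlock
  (rowMass blockNorm blockNorm_nonneg rowMass_le_blockNorm blockNorm_le_of_rowMass_le BlockWalkExpansion)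
open Summit.QuantumFields.BalabanUV.Gaps.D4WalkBlockDerivative
  (blockDominated_of_local differentiableOn_perturb_entry blockWalkExpansion_perturb_of_derivLetters)
open Summit.QuantumFields.BalabanUV.Gaps.D4WalkBlockFlatLetters (cubeOf blockWalkExpansion_const)
open Summit.QuantumFields.BalabanUV.Gaps.D4WalkBlockFlatFibre (flatLettersFibre_oneScaleTorus)

open Summit.QuantumFields.BalabanUV.Gaps.D4WalkBlockCovariantGeometry
  (fibDiag SBf differentiableOn_fibDiag_entry fibDiag_local blockNorm_fibDiag_le blockNorm_SBf_mul_le SBf_mul_apply shift_unshift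
    fibDiag_add fibDiag_smul fibDiag_sum)

/-! ## §3. The covariant shift `V_W(u)` in (3.52)-structured form; its (3.61) letter from the two windows; holomorphy -/

section CovShift
variable (P : Params) (F : Type) [Fintype F] [DecidableEq F]
variable {E : Type*} [NormedAddCommGroup E] [NormedSpace ℂ E]

/-- The fibred forward η-difference `∂^η_μ ⊗ 1_F` (as in `D4WalkBlockFlatFibre`). -/
abbrev Df (μ : Fin P.d) : Matrix (Site P 0 × F) (Site P 0 × F) ℂ :=
  Matrix.blockDiagonal fun _ : F => (deriv P 0 P.eps μ).map ((↑) : ℝ → ℂ)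

/-- The difference operators of the (3.52)-structure: forward `∂_μ ⊗ 1` and backward-relabelled `S⁻_μ(∂_μ ⊗ 1)`. -/
def covDop : Fin P.d ⊕ Fin P.d → Matrix (Site P 0 × F) (Site P 0 × F) ℂ
  | Sum.inl μ => Df P F μ
  | Sum.inr μ => SBf P F μ * Df P F μ

/-- The relative derivative letters of `covDop`: `1` forward, `e^{½δ₀}` backward (one-cube relabelling). -/
def covB (δ₀ : ℝ) : Fin P.d ⊕ Fin P.d → ℝ
  | Sum.inl _ => 1
  | Sum.inr _ => Real.exp (δ₀ / 2)

variable (Wp Wm : Fin P.d → E → Site P 0 → Matrix F F ℂ)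

/-- The first-order coefficients: `η⁻¹W⁺_μ(u,x)` on `∂_μ ⊗ 1`, `−η⁻¹W⁻_μ(u,x)` on `S⁻_μ∂_μ ⊗ 1` (site-local in the fibre).
[cite: Balaban1985BackgroundPropagators, (3.52) p.400] -/
def covCoeff : Fin P.d ⊕ Fin P.d → E → Matrix (Site P 0 × F) (Site P 0 × F) ℂ
  | Sum.inl μ => fun u => fibDiag P F fun x => (P.eps⁻¹ : ℂ) • Wp μ u x
  | Sum.inr μ => fun u => fibDiag P F fun x => (-(P.eps⁻¹ : ℂ)) • Wm μ u x

/-- The zeroth-order coefficient `η⁻²Σ_{b∈st(x)}W_b(u)` — the DIVERGENCE of the defects (print: first order `iη²ad_{(∇*A)(x)}`).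
[cite: Balaban1985BackgroundPropagators, (3.52) p.400, (3.54) p.401] -/
def covCoeff₀ : E → Matrix (Site P 0 × F) (Site P 0 × F) ℂ :=
  fun u => fibDiag P F fun x => ((P.eps⁻¹ : ℂ) ^ 2) • ∑ μ, (Wp μ u x + Wm μ u x)

/-- **THE COVARIANT SHIFT `V_W(u) = Δ_1 ⊗ 1 − Δ_W(u)`** in the (3.52)-structured form `a₀(u) + Σ_ι a_ι(u)·D_ι` (the display of the
module docstring: `S_μ = 1 + η∂_μ`, `S⁻_μ = 1 − ηS⁻_μ∂_μ` applied to `η⁻²Σ_μ(W⁺_μS_μ + W⁻_μS⁻_μ)`). [cite: Balaban1985BackgroundPropagators, (3.50)–(3.53) pp.400–401] -/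
def covShift (u : E) : Matrix (Site P 0 × F) (Site P 0 × F) ℂ :=
  covCoeff₀ P F Wp Wm u + ∑ ι, covCoeff P F Wp Wm ι u * covDop P F ι

variable {P F Wp Wm}

omit [Fintype F] [DecidableEq F] [NormedAddCommGroup E] [NormedSpace ℂ E] in
/-- unfolding of the forward coefficient. -/
theorem covCoeff_inl (μ : Fin P.d) (u : E) :
    covCoeff P F Wp Wm (Sum.inl μ) u = fibDiag P F fun x => (P.eps⁻¹ : ℂ) • Wp μ u x := rfl

omit [Fintype F] [DecidableEq F] [NormedAddCommGroup E] [NormedSpace ℂ E] in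
/-- unfolding of the backward coefficient. -/
theorem covCoeff_inr (μ : Fin P.d) (u : E) :
    covCoeff P F Wp Wm (Sum.inr μ) u = fibDiag P F fun x => (-(P.eps⁻¹ : ℂ)) • Wm μ u x := rfl

omit [Fintype F] [DecidableEq F] [NormedAddCommGroup E] [NormedSpace ℂ E] in
/-- unfolding of the divergence coefficient. -/
theorem covCoeff₀_apply (u : E) :
    covCoeff₀ P F Wp Wm u = fibDiag P F fun x => ((P.eps⁻¹ : ℂ) ^ 2) • ∑ μ, (Wp μ u x + Wm μ u x) := rfl

omit [DecidableEq F] in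
/-- the fibre row masses of a scaled family. -/
private theorem sum_norm_smul_le {w : Matrix F F ℂ} (c : ℂ) {β : ℝ} (a : F) (h : ∑ b, ‖w a b‖ ≤ β) :
    ∑ b, ‖(c • w) a b‖ ≤ ‖c‖ * β := by
  calc ∑ b, ‖(c • w) a b‖ = ‖c‖ * ∑ b, ‖w a b‖ := by
        rw [Finset.mul_sum]; exact Finset.sum_congr rfl fun b _ => by rw [Matrix.smul_apply, smul_eq_mul, norm_mul]
    _ ≤ ‖c‖ * β := mul_le_mul_of_nonneg_left h (norm_nonneg c)

omit [NormedSpace ℂ E] in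
/-- **THE (3.61)-SHAPE DOMINATION LETTER OF `V_W` FROM THE TWO WINDOWS.**  BOND window: `Σ_b‖W^±_μ(u,x)_{ab}‖ ≤ ηα` on the ball
(print (3.37): `|U′_b − 1| ≈ η|A(b)| ≤ ηα₁(Lʲη)⁻¹`); DIVERGENCE window: `Σ_b‖(Σ_μ W⁺_μ + W⁻_μ)(u,x)_{ab}‖ ≤ η²α′` ((3.37): `|∇A| ≤ α₁(Lʲη)⁻²`
through `Σ_{b∈st(x)}W_b = iη²ad_{∇*A} + O(η²α₁²)`) ⟹ for every cube map factoring through the site and every `S`: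
`‖V_W(u)S‖_{Y,Y′} ≤ α′‖S‖_{Y,Y′} + Σ_ι α‖D_ιS‖_{Y,Y′}` — NO `η⁻¹`: the `η⁻¹`, `η⁻²` of the coefficients are eaten by the windows' `η`, `η²`.
[cite: Balaban1985BackgroundPropagators, (3.54) p.401, (3.61) p.402, (3.37) p.396] -/
theorem covShift_dominated {ν : ℕ} {Kv : Fin ν → ℕ} (cub : Site P 0 → UT Kv) {R α α' : ℝ} (hα : 0 ≤ α) (hα' : 0 ≤ α')
    (hWp : ∀ μ, ∀ u ∈ ball (0 : E) R, ∀ x a, ∑ b, ‖Wp μ u x a b‖ ≤ P.eps * α)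
    (hWm : ∀ μ, ∀ u ∈ ball (0 : E) R, ∀ x a, ∑ b, ‖Wm μ u x a b‖ ≤ P.eps * α)
    (hdiv : ∀ u ∈ ball (0 : E) R, ∀ x a, ∑ b, ‖(∑ μ, (Wp μ u x + Wm μ u x)) a b‖ ≤ P.eps ^ 2 * α') :
    ∀ u ∈ ball (0 : E) R, ∀ (S : Matrix (Site P 0 × F) (Site P 0 × F) ℂ) (Y Y' : UT Kv),
      blockNorm (fun p : Site P 0 × F => cub p.1) (fun p : Site P 0 × F => cub p.1) (covShift P F Wp Wm u * S) Y Y' ≤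
        α' * blockNorm (fun p : Site P 0 × F => cub p.1) (fun p : Site P 0 × F => cub p.1) S Y Y' +
          ∑ ι, α * blockNorm (fun p : Site P 0 × F => cub p.1) (fun p : Site P 0 × F => cub p.1) (covDop P F ι * S) Y Y' := by
  intro u hu S Y Y'
  have hε : 0 < P.eps := by unfold Params.eps; exact pow_pos (inv_pos.2 P.cast_L_pos) _
  have hnorm : ‖(P.eps⁻¹ : ℂ)‖ = P.eps⁻¹ := by
    rw [← Complex.ofReal_inv, Complex.norm_real, Real.norm_eq_abs, abs_of_pos (inv_pos.2 hε)]
  -- cube-locality of all coefficients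
  have hloc₀ : ∀ p q, covCoeff₀ P F Wp Wm u p q ≠ 0 → cub p.1 = cub q.1 := fun p q h => by
    rw [covCoeff₀_apply] at h; exact fibDiag_local cub _ p q h
  have hloc : ∀ ι p q, covCoeff P F Wp Wm ι u p q ≠ 0 → cub p.1 = cub q.1 := fun ι p q h => by
    cases ι with
    | inl μ => rw [covCoeff_inl] at h; exact fibDiag_local cub _ p q h
    | inr μ => rw [covCoeff_inr] at h; exact fibDiag_local cub _ p q h
  -- diagonal block bounds: the η⁻² ∕ η⁻¹ of the coefficients against the η² ∕ η of the windows
  have hbd₀ : ∀ Y, blockNorm (fun p : Site P 0 × F => cub p.1) (fun p : Site P 0 × F => cub p.1)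
      (covCoeff₀ P F Wp Wm u) Y Y ≤ α' := fun Y => by
    rw [covCoeff₀_apply]
    refine blockNorm_fibDiag_le cub _ hα' (fun x a => (sum_norm_smul_le _ a (hdiv u hu x a)).trans ?_) Y
    rw [norm_pow, hnorm, ← mul_assoc, inv_pow, inv_mul_cancel₀ (pow_ne_zero 2 hε.ne'), one_mul]
  have hbd : ∀ ι Y, blockNorm (fun p : Site P 0 × F => cub p.1) (fun p : Site P 0 × F => cub p.1)
      (covCoeff P F Wp Wm ι u) Y Y ≤ α := fun ι Y => by
    cases ι with
    | inl μ =>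
        rw [covCoeff_inl]
        refine blockNorm_fibDiag_le cub _ hα (fun x a => (sum_norm_smul_le _ a (hWp μ u hu x a)).trans ?_) Y
        rw [hnorm, ← mul_assoc, inv_mul_cancel₀ hε.ne', one_mul]
    | inr μ =>
        rw [covCoeff_inr]
        refine blockNorm_fibDiag_le cub _ hα (fun x a => (sum_norm_smul_le _ a (hWm μ u hu x a)).trans ?_) Y
        rw [norm_neg, hnorm, ← mul_assoc, inv_mul_cancel₀ hε.ne', one_mul]
  exact blockDominated_of_local (fun p : Site P 0 × F => cub p.1) (fun p : Site P 0 × F => cub p.1) (covDop P F)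
    (covCoeff₀ P F Wp Wm u) (fun ι => covCoeff P F Wp Wm ι u) (α := fun _ => α) hloc₀ hbd₀ hloc hbd S Y Y'

/-- `V_W(u)` is entrywise holomorphic when the defects are. [cite: Balaban1985BackgroundPropagators, p.400 («F′_{1,k}(iad_{A′(b)}) is an analytic function of A(b)»), Thm 3.4 p.400] -/
theorem covShift_holo {R : ℝ} (hWp : ∀ μ x a b, DifferentiableOn ℂ (fun u => Wp μ u x a b) (ball (0 : E) R))
    (hWm : ∀ μ x a b, DifferentiableOn ℂ (fun u => Wm μ u x a b) (ball (0 : E) R)) :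
    ∀ p q, DifferentiableOn ℂ (fun u => covShift P F Wp Wm u p q) (ball (0 : E) R) := by
  intro p q
  refine differentiableOn_perturb_entry (E := E) (Dop := covDop P F) (a₀ := covCoeff₀ P F Wp Wm)
    (a := fun ι u => covCoeff P F Wp Wm ι u) (fun i k => ?_) (fun ι i l => ?_) p q
  · show DifferentiableOn ℂ (fun u => fibDiag P F (fun x => ((P.eps⁻¹ : ℂ) ^ 2) • ∑ μ, (Wp μ u x + Wm μ u x)) i k) _
    refine differentiableOn_fibDiag_entry (w := fun u x => ((P.eps⁻¹ : ℂ) ^ 2) • ∑ μ, (Wp μ u x + Wm μ u x))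
      (fun x a b => ?_) i k
    simp only [Matrix.smul_apply, smul_eq_mul, Matrix.sum_apply, Matrix.add_apply]
    exact (differentiableOn_const _).mul (DifferentiableOn.fun_sum fun μ _ => (hWp μ x a b).add (hWm μ x a b))
  · cases ι with
    | inl μ =>
        show DifferentiableOn ℂ (fun u => fibDiag P F (fun x => (P.eps⁻¹ : ℂ) • Wp μ u x) i l) _
        refine differentiableOn_fibDiag_entry (w := fun u x => (P.eps⁻¹ : ℂ) • Wp μ u x) (fun x a b => ?_) i l
        simp only [Matrix.smul_apply, smul_eq_mul]
        exact (differentiableOn_const _).mul (hWp μ x a b)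
    | inr μ =>
        show DifferentiableOn ℂ (fun u => fibDiag P F (fun x => (-(P.eps⁻¹ : ℂ)) • Wm μ u x) i l) _
        refine differentiableOn_fibDiag_entry (w := fun u x => (-(P.eps⁻¹ : ℂ)) • Wm μ u x) (fun x a b => ?_) i l
        simp only [Matrix.smul_apply, smul_eq_mul]
        exact (differentiableOn_const _).mul (hWm μ x a b)

end CovShift
/-! ## §4. Cor. 3.5's step for the covariant-Laplacian part on the genuine flat propagator, k-, volume- and fibre-uniform -/

section Step
variable {d L : ℕ} {a msq : ℝ}
variable {dd N' : ℕ} {E : Type*} [NormedAddCommGroup E] [NormedSpace ℂ E]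

/-- **[B9] COR. 3.5's STEP FOR THE COVARIANT SHIFT ON THE GENUINE FLAT PROPAGATOR.**  There are `δ₀, C > 0` (B6's, functions of
`d, L, a, m²`) such that for EVERY member `i : Index d L` of the one-scale torus family, every finite fibre `F`, every holomorphic
family of transport defects `W^±_μ(u, x) ∈ Matrix F F ℂ` on a ball with the BOND window `Σ_b‖W^±_μ(u,x)_{ab}‖ ≤ ηα` and the DIVERGENCE
window `Σ_b‖(Σ_μ W⁺_μ + W⁻_μ)(u,x)_{ab}‖ ≤ η²α′` (`η = i.P.eps = L^{−K}`, `α, α′ ≥ 0`), every cube row sum `(μ, c_μ)`, rates `0 ≤ μ`,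
`2μ ≤ ε`, `2μ ≤ ½δ₀ − ε − μ`, and the MARGIN `c_μ(c_μ·1·(1·((α′ + Σ_ι α·covB δ₀ ι)C))c_μ)c_μ < 1` (`Σ_ι α·covB = d·α(1 + e^{½δ₀})`:
«α₁ sufficiently small» against `(C, δ₀, c_μ, d)` ONLY): with `Gc ⊗ 1 = blockDiagonal (G′_K.map ofReal)`,
`(Gc ⊗ 1)(1 − V_W(u)(Gc ⊗ 1))⁻¹` — the walk-expansion content of `(Δ_W + m² + a_KQ′(1)*Q′(1))⁻¹`, the propagator whose Laplacian
sits in the background `U′` while the averaging stays flat — is a block walk expansion at `(ε − 2μ, ½δ₀ − ε − 3μ, c_μC(1·(1−q)⁻¹)c_μ,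
½δ₀ − 2μ)` with the relative derivative letters `covB δ₀` and dominating distances; NO constant depends on `K`, the volume, the fibre
or `η⁻¹`. [cite: Balaban1985BackgroundPropagators, Cor. 3.5 p.407, (3.50)–(3.54) pp.400–401, (3.60)–(3.64) p.402, (3.37) p.396; Balaban1984PropagatorsII, Prop. 2.2 (2.67) p.234; Balaban1988RG2Cluster, (1.11) p.5] -/
theorem blockWalkExpansion_covShift_oneScaleTorus (hd : 1 ≤ d) (hL : Odd L ∧ 1 < L) (ha : 0 < a) (hmsq : 0 ≤ msq) :
    ∃ δ₀ C : ℝ, 0 < δ₀ ∧ 0 < C ∧ ∀ (i : Index d L) (F : Type) [Fintype F] [DecidableEq F] (c₀ : B13.Consts)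
      (X : Finset (UT (Nv i.P i.P.K))) (R : ℝ) (Wp Wm : Fin i.P.d → E → Site i.P 0 → Matrix F F ℂ) (α α' ε μ cμ : ℝ),
      (∀ ν x a' b, DifferentiableOn ℂ (fun u => Wp ν u x a' b) (ball (0 : E) R)) →
      (∀ ν x a' b, DifferentiableOn ℂ (fun u => Wm ν u x a' b) (ball (0 : E) R)) →
      0 ≤ α → 0 ≤ α' →
      (∀ ν, ∀ u ∈ ball (0 : E) R, ∀ x a', ∑ b, ‖Wp ν u x a' b‖ ≤ i.P.eps * α) →
      (∀ ν, ∀ u ∈ ball (0 : E) R, ∀ x a', ∑ b, ‖Wm ν u x a' b‖ ≤ i.P.eps * α) →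
      (∀ u ∈ ball (0 : E) R, ∀ x a', ∑ b, ‖(∑ ν, (Wp ν u x + Wm ν u x)) a' b‖ ≤ i.P.eps ^ 2 * α') →
      0 ≤ μ → 2 * μ ≤ ε → 2 * μ ≤ δ₀ / 2 - ε - μ → 0 ≤ cμ →
      RowSum (toB6 (torusGeom (Nv i.P i.P.K) 0 0 0) 0 True) μ cμ →
      cμ * (cμ * 1 * (1 * ((α' + ∑ ι, α * covB i.P δ₀ ι) * C)) * cμ) * cμ < 1 →
      ∃ (W : Type) (T : W → (TPt dd N' → ℂ) → E → Matrix (Site i.P 0 × F) (Site i.P 0 × F) ℂ) (SX' : Set W) (A' : W → ℝ)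
        (D' : W → UT (Nv i.P i.P.K) → UT (Nv i.P i.P.K) → ℝ),
        BlockWalkExpansion c₀ (fun q : Site i.P 0 × F => cubeOf i.P q.1) (fun q : Site i.P 0 × F => cubeOf i.P q.1)
          (fun (_ : TPt dd N' → ℂ) u =>
            Matrix.blockDiagonal (fun _ : F => ((tower i.P a msq).G i.P.K).map ((↑) : ℝ → ℂ)) *
              (1 - covShift i.P F Wp Wm u *
                Matrix.blockDiagonal (fun _ : F => ((tower i.P a msq).G i.P.K).map ((↑) : ℝ → ℂ)))⁻¹) X R
          (ε - 2 * μ) (δ₀ / 2 - ε - μ - 2 * μ)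
          (cμ * C * (1 * (1 - cμ * (cμ * 1 * (1 * ((α' + ∑ ι, α * covB i.P δ₀ ι) * C)) * cμ) * cμ)⁻¹) * cμ)
          T SX' A' D' (δ₀ / 2 - 2 * μ) ∧
        (∀ (ι : Fin i.P.d ⊕ Fin i.P.d) ω (σ : TPt dd N' → ℂ), (∀ j, ‖σ j‖ ≤ Real.exp c₀.κ₁) → ∀ u ∈ ball (0 : E) R, ∀ Y Y',
          blockNorm (fun q : Site i.P 0 × F => cubeOf i.P q.1) (fun q : Site i.P 0 × F => cubeOf i.P q.1)
              (covDop i.P F ι * T ω σ u) Y Y' ≤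
            covB i.P δ₀ ι * (A' ω * Real.exp (-((δ₀ / 2 - 2 * μ) * D' ω Y Y')))) ∧
        ∀ ω, DomBy (toB6 (torusGeom (Nv i.P i.P.K) 0 0 0) 0 True) (D' ω) := by
  obtain ⟨δ₀, C, hδ₀, hC, hflat⟩ := flatLettersFibre_oneScaleTorus d L hd hL ha hmsq
  refine ⟨δ₀, C, hδ₀, hC, fun i F _ _ c₀ X R Wp Wm α α' ε μ cμ hWph hWmh hα hα' hWp hWm hdiv hμ hμε hμκ hcμ hrow hq => ?_⟩
  set Gf := Matrix.blockDiagonal (fun _ : F => ((tower i.P a msq).G i.P.K).map ((↑) : ℝ → ℂ)) with hGf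
  -- the flat fibred propagator as a one-term expansion
  have hW := blockWalkExpansion_const (dd := dd) (N' := N') (E := E) c₀ (fun q : Site i.P 0 × F => cubeOf i.P q.1) X Gf R
    (ε := ε) (κ := δ₀ / 2 - ε - μ) (ρ := δ₀ / 2) hC.le (by linarith) (fun Y Y' => (hflat i F Y Y').1)
  -- derivative letters: forward (B = 1) from 58, backward-relabelled (B = e^{½δ₀}) by §2
  have hD : ∀ (ι : Fin i.P.d ⊕ Fin i.P.d) (ω : Unit) (σ : TPt dd N' → ℂ), (∀ j, ‖σ j‖ ≤ Real.exp c₀.κ₁) →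
      ∀ u ∈ ball (0 : E) R, ∀ Y Y' : UT (Nv i.P i.P.K),
        blockNorm (fun q : Site i.P 0 × F => cubeOf i.P q.1) (fun q : Site i.P 0 × F => cubeOf i.P q.1)
            (covDop i.P F ι * Gf) Y Y' ≤ covB i.P δ₀ ι * (C * Real.exp (-(δ₀ / 2 * tdist1 (Nv i.P i.P.K) Y Y'))) := by
    intro ι _ σ _ u _ Y Y'
    cases ι with
    | inl ν =>
        show blockNorm _ _ (Df i.P F ν * Gf) Y Y' ≤ 1 * _
        rw [one_mul]; exact (hflat i F Y Y').2 ν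
    | inr ν =>
        show blockNorm _ _ (SBf i.P F ν * Df i.P F ν * Gf) Y Y' ≤ Real.exp (δ₀ / 2) * _
        rw [Matrix.mul_assoc]
        have h := blockNorm_SBf_mul_le ν (Df i.P F ν * Gf) hC.le (by linarith : (0 : ℝ) ≤ δ₀ / 2)
          (fun Y Y' => (hflat i F Y Y').2 ν) Y Y'
        calc _ ≤ _ := h
          _ = _ := by ring
  exact blockWalkExpansion_perturb_of_derivLetters (Dop := covDop i.P F) (B := covB i.P δ₀) hW (fun _ Y Y' => le_rfl)
    (fun ι => by cases ι <;> simp only [covB] <;> positivity) hD (covShift_holo hWph hWmh) hα' (fun _ => hα)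
    (covShift_dominated (fun x => cubeOf i.P x) hα hα' hWp hWm hdiv) hμ hμε hμκ (by linarith) hC.le hcμ hrow hq

end Step
/-! ## §5. Faithfulness: `covShift = Δ_1 ⊗ 1 − Δ_W` for the covariant Laplacian (3.50) with defects -/

section Faithful
variable (P : Params) (F : Type) [Fintype F] [DecidableEq F]
variable {E : Type*} [NormedAddCommGroup E] [NormedSpace ℂ E]

/-- The fibred FORWARD shift `S_μ ⊗ 1_F`: `(Sλ)(x,a) = λ(x + e_μ, a)`. -/
def Sf (μ : Fin P.d) : Matrix (Site P 0 × F) (Site P 0 × F) ℂ :=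
  Matrix.of fun p q => if q = (Site.shift p.1 μ, p.2) then 1 else 0

variable (Wp Wm : Fin P.d → E → Site P 0 → Matrix F F ℂ)

/-- **THE COVARIANT LAPLACIAN WITH TRANSPORT DEFECTS** — (3.50) at `U = 1` with `R(U′_b) = 1 + W_b`:
`(Δ_Wλ)(x) = η⁻²Σ_μ(2λ(x) − (1 + W⁺_μ(x))λ(x + e_μ) − (1 + W⁻_μ(x))λ(x − e_μ))`. [cite: Balaban1985BackgroundPropagators, (3.50) p.400, (3.23) p.394] -/
def covLap (u : E) : Matrix (Site P 0 × F) (Site P 0 × F) ℂ :=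
  ((P.eps⁻¹ : ℂ) ^ 2) • ∑ μ, ((2 : ℂ) • (1 : Matrix (Site P 0 × F) (Site P 0 × F) ℂ) -
    (1 + fibDiag P F (Wp μ u)) * Sf P F μ - (1 + fibDiag P F (Wm μ u)) * SBf P F μ)

/-- The flat fibred Laplacian `Δ_1 ⊗ 1 = η⁻²Σ_μ(2 − S_μ − S⁻_μ)` (all defects zero). [cite: Balaban1985BackgroundPropagators, (3.23) p.394] -/
def flatLap : Matrix (Site P 0 × F) (Site P 0 × F) ℂ :=
  ((P.eps⁻¹ : ℂ) ^ 2) • ∑ μ : Fin P.d, ((2 : ℂ) • (1 : Matrix (Site P 0 × F) (Site P 0 × F) ℂ) - Sf P F μ - SBf P F μ)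

variable {P F Wp Wm}

/-- `S_μ = 1 + η∂_μ` on the fine torus (the definition of `B1RG242Torus.deriv`, solved for the shift). -/
theorem shiftMat_eq (μ : Fin P.d) : B1RG242Torus.shiftMat P 0 μ = 1 + P.eps • deriv P 0 P.eps μ := by
  have hε : P.eps ≠ 0 := by
    have : 0 < P.eps := by unfold Params.eps; exact pow_pos (inv_pos.2 P.cast_L_pos) _
    exact this.ne'
  rw [show deriv P 0 P.eps μ = P.eps⁻¹ • (B1RG242Torus.shiftMat P 0 μ - 1) from rfl, smul_smul, mul_inv_cancel₀ hε,
    one_smul, add_sub_cancel]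

omit [Fintype F] in
/-- The fibred forward shift is `shiftMat ⊗ 1_F`. -/
theorem Sf_eq_blockDiagonal (μ : Fin P.d) :
    Sf P F μ = Matrix.blockDiagonal fun _ : F => (B1RG242Torus.shiftMat P 0 μ).map ((↑) : ℝ → ℂ) := by
  ext p q
  rw [show p = (p.1, p.2) from rfl, show q = (q.1, q.2) from rfl, Matrix.blockDiagonal_apply]
  simp only [Sf, Matrix.of_apply, Matrix.map_apply, B1RG242Torus.shiftMat, Prod.mk.injEq]
  by_cases h2 : p.2 = q.2
  · by_cases h1 : q.1 = Site.shift p.1 μ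
    · simp [h1, h2]
    · simp [h1, h2]
  · have h2' : ¬ q.2 = p.2 := fun h => h2 h.symm
    simp [h2, h2']

omit [Fintype F] in
/-- **`S_μ ⊗ 1 = 1 + η(∂_μ ⊗ 1)`**. -/
theorem Sf_eq (μ : Fin P.d) : Sf P F μ = 1 + (P.eps : ℂ) • Df P F μ := by
  rw [Sf_eq_blockDiagonal, shiftMat_eq]
  have e : (1 + P.eps • deriv P 0 P.eps μ).map ((↑) : ℝ → ℂ) =
      1 + (P.eps : ℂ) • (deriv P 0 P.eps μ).map ((↑) : ℝ → ℂ) := by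
    ext x y
    simp only [Matrix.map_apply, Matrix.add_apply, Matrix.smul_apply, Matrix.one_apply, smul_eq_mul]
    split_ifs <;> push_cast <;> ring
  rw [e]
  show Matrix.blockDiagonal ((1 : F → Matrix (Site P 0) (Site P 0) ℂ) +
      (P.eps : ℂ) • (fun _ : F => (deriv P 0 P.eps μ).map ((↑) : ℝ → ℂ))) = _
  rw [Matrix.blockDiagonal_add, Matrix.blockDiagonal_one, Matrix.blockDiagonal_smul]

/-- **`S⁻_μS_μ = 1`** (`(x − e_μ) + e_μ = x`). -/
theorem SBf_mul_Sf (μ : Fin P.d) : SBf P F μ * Sf P F μ = 1 := by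
  ext p q
  rw [SBf_mul_apply]
  simp only [Sf, Matrix.of_apply, shift_unshift, Matrix.one_apply]
  by_cases h : p = q
  · subst h; simp
  · have : ¬ q = (p.1, p.2) := fun h' => h (by rw [h']); simp [h, this]

/-- **`S⁻_μ = 1 − ηS⁻_μ(∂_μ ⊗ 1)`**. -/
theorem SBf_eq (μ : Fin P.d) : SBf P F μ = 1 - (P.eps : ℂ) • (SBf P F μ * Df P F μ) := by
  have h := SBf_mul_Sf (P := P) (F := F) μ
  rw [Sf_eq, Matrix.mul_add, Matrix.mul_one, Matrix.mul_smul] at h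
  rw [eq_sub_iff_add_eq]; exact h

omit [NormedAddCommGroup E] [NormedSpace ℂ E] in
/-- **FAITHFULNESS — `Δ_1 ⊗ 1 − Δ_W = V_W`**: the structured `covShift` IS the perturbation of (3.50)'s covariant Laplacian with
defects (`S_μ = 1 + η∂_μ`, `S⁻_μ = 1 − ηS⁻_μ∂_μ` substituted into `η⁻²Σ_μ(W⁺_μS_μ + W⁻_μS⁻_μ)`). [cite: Balaban1985BackgroundPropagators, (3.50)–(3.53) pp.400–401] -/
theorem flatLap_sub_covLap (u : E) : flatLap P F - covLap P F Wp Wm u = covShift P F Wp Wm u := by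
  have hε : (P.eps : ℂ) ≠ 0 := by
    have : 0 < P.eps := by unfold Params.eps; exact pow_pos (inv_pos.2 P.cast_L_pos) _
    exact_mod_cast this.ne'
  have h1 : flatLap P F - covLap P F Wp Wm u =
      ((P.eps⁻¹ : ℂ) ^ 2) • ∑ μ, (fibDiag P F (Wp μ u) * Sf P F μ + fibDiag P F (Wm μ u) * SBf P F μ) := by
    unfold flatLap covLap
    rw [← smul_sub, ← Finset.sum_sub_distrib]
    congr 1
    refine Finset.sum_congr rfl fun μ _ => ?_
    noncomm_ring
  rw [h1]
  have h2 : ∀ μ, fibDiag P F (Wp μ u) * Sf P F μ + fibDiag P F (Wm μ u) * SBf P F μ =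
      (fibDiag P F (Wp μ u) + fibDiag P F (Wm μ u)) + (P.eps : ℂ) • (fibDiag P F (Wp μ u) * Df P F μ) -
        (P.eps : ℂ) • (fibDiag P F (Wm μ u) * (SBf P F μ * Df P F μ)) := by
    intro μ
    conv_lhs => rw [Sf_eq (P := P) (F := F) μ, SBf_eq (P := P) (F := F) μ]
    rw [Matrix.mul_add, Matrix.mul_one, Matrix.mul_smul, Matrix.mul_sub, Matrix.mul_one, Matrix.mul_smul]
    abel
  simp_rw [h2]
  unfold covShift covCoeff₀
  rw [Fintype.sum_sum_type]
  simp only [covCoeff, covDop]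
  rw [fibDiag_smul, fibDiag_sum]
  simp only [fibDiag_add, fibDiag_smul]
  rw [Finset.sum_sub_distrib, Finset.sum_add_distrib, smul_sub, smul_add, Finset.smul_sum, Finset.smul_sum,
    Finset.smul_sum]
  have e3 : ∀ μ, ((P.eps⁻¹ : ℂ) ^ 2) • ((P.eps : ℂ) • (fibDiag P F (Wp μ u) * Df P F μ)) =
      ((P.eps⁻¹ : ℂ) • fibDiag P F (Wp μ u)) * Df P F μ := fun μ => by
    rw [smul_smul, Matrix.smul_mul, pow_two, mul_assoc, inv_mul_cancel₀ hε, mul_one]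
  have e4 : ∀ μ, ((P.eps⁻¹ : ℂ) ^ 2) • ((P.eps : ℂ) • (fibDiag P F (Wm μ u) * (SBf P F μ * Df P F μ))) =
      -(((-(P.eps⁻¹ : ℂ)) • fibDiag P F (Wm μ u)) * (SBf P F μ * Df P F μ)) := fun μ => by
    rw [smul_smul, Matrix.smul_mul, neg_smul, neg_neg, pow_two, mul_assoc, inv_mul_cancel₀ hε, mul_one]
  simp_rw [e3, e4, Finset.sum_neg_distrib, sub_neg_eq_add, ← Finset.smul_sum]
  abel

end Faithful
end Summit.QuantumFields.BalabanUV.Gaps.D4WalkBlockCovariantShift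

end
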